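import Literature.AlgebraicGeometry.Hyperkaehler.GeneralizedKummerHilbertSchemePullback
import Literature.AlgebraicTopology.SingularHomology.FiniteDeckTransfer
import HarnessLib

/-!
# The translation action of an abelian surface on its Hilbert schemes of points, and Beauville's isotrivial
square `A × Kⁿ(A) → A^[n+1]` (a Galois cover with group `A[n+1]`) — DEFINITIONS + NAMED FACTS (F6 of the
`hodge-kum4` lane-V brief; the infrastructure the proof of V0 = `Summit.Ventures.HodgeKum4.HilbertKummerTransfer`
needs)

Layer `Literature/AlgebraicGeometry/HilbertScheme` (sequel of `Hyperkaehler/GeneralizedKummerHilbertSchemePullback`,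
whose raw Kummer data `Ξ 𝒜 x₀ j` + `IsHilbertSchemeOfPoints` + `IsPullback` we keep).  Statement-level
(director-hodge 2026-08-27 (R4): "statement first, proofs later"): definitions with bodies, the existence and
uniqueness of the translation action PROVED, and one printed fact (the Galois cover).

## Sources (read)

* A. Beauville, *Variétés kählériennes dont la première classe de Chern est nulle*, J. Differential Geom. 18 (1983)
  §7 p. 769 (materialised text `paper:doi-10-4310-jdg-1214438181` p0015): "Considérons l'application
  `s : A^{(r+1)} → A` définie par `s([p₀] + ⋯ + [p_r]) = Σ pᵢ`. Par composition avec `ε` on en déduit un morphisme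
  `S : A^[r+1] → A`.  Observons que le groupe `A` agit sur `A^[r+1]` par translations, et sur `A` par la loi
  d'opération `(t, x) ↦ x + (r+1)t`; l'application `S` est équivariante par rapport à ces deux actions. Il en
  résulte que `S` est lisse et que ses fibres sont isomorphes entre elles.²  On note `K_r` la variété lisse
  `S⁻¹(0)`", with footnote 2: "Plus précisément, le morphisme `S` est «isotrivial»: on a un diagramme cartésien
  `A × K_r → A^[r+1]` (top), `A → A` multiplication by `(r+1)` (bottom), vertical maps `pr₁` and `S`."
* S. Kapfer, G. Menet, *Integral cohomology of the generalized Kummer fourfold*, Algebraic Geometry 5 (2018),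
  Lemma 5.4 and its proof (arXiv:1607.03431 p. 13): "For a point `a ∈ A`, we denote by `t_a` the morphism on
  `A^[n]` induced by the translation by `a`. Then we consider the morphism `Θ : K_{n−1}(A) × A ⟶ A^[n]` defined by
  `Θ(ξ, a) = t_a(θ(ξ))`. It fits in a pullback diagram [`Θ` over `pr₂`, `Σ : A^[n] → A` over `n· : A → A`] that
  realizes `K_{n−1}(A) × A` as a `n⁴`-fold covering of `A^[n]` over `A`."
* The Stacks Project, Tag 0B94 (functor of points of the Hilbert scheme; tree `IsHilbertSchemeOfPoints`).
* A. Hatcher, *Algebraic Topology* (2002) §1.3 / §3.G (deck transformations, transfer; tree `FiniteDeckCover`).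

## Rendering (points-free, on the tree's carriers)

`A : Motives.AbelianVariety ℂ` is a group object of `SchemeOver ℂ` (Mathlib `GrpObj`; morphisms `T ⟶ A.X` form a
group, `MonObj.Hom.group`, scoped instance — `f * g = lift f g ≫ μ`, `1 = toUnit ≫ η`, `f⁻¹ = f ≫ ι`).
* `AbelianVariety.translate A a = t_a : A.X ⟶ A.X`, `x ↦ a·x`, for a point `a : 𝟙_ ⟶ A.X`.
* For a Hilbert scheme `(H, Ξ)` of `A` (`IsHilbertSchemeOfPoints n A.X H Ξ`, `Ξ ⊂ A × H` the universal family)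
  the TRANSLATED FAMILY over `A × H` is the subscheme `{(x, (a, ξ)) | a⁻¹x ∈ Ξ_ξ}` of `A × (A × H)`: the base change
  of `Ξ` to `A × H` pulled back along the shear automorphism `(x, (a, ξ)) ↦ (a⁻¹x, (a, ξ))` (`translateShear`,
  `translatedFamily`).  **`IsTranslationAction A Ξ act`** says that `act : A.X ⊗ H ⟶ H` CLASSIFIES it:
  `(A × act)^* Ξ = translatedFamily` — i.e. `Ξ_{act(a, ξ)} = t_a(Ξ_ξ)`; such an `act` is unique
  (`IsTranslationAction.unique`, from the universal property) and EXISTS: `translatedFamily_mem` PROVES that the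
  translated family is a point of `Hilb^n` (base change + automorphism over the base), so
  `translationAction hH := hH.lift …` is THE action (`isTranslationAction_translationAction`,
  `IsTranslationAction.eq_translationAction`) and the record `Beauville1983_hilbertScheme_translationAction`
  (Beauville's "`A` agit sur `A^[r+1]` par translations") is DISCHARGED (`_holds`).
* `translateHilb act a = t_a^{[n]} : H ⟶ H`; `kummerCover act j = Θ : A.X ⊗ K ⟶ H`, `(a, ξ) ↦ t_a(j ξ)` (Beauville's
  `u`, Kapfer–Menet's `Θ` with the factors swapped); `IsKummerTranslation act j a τ`: `τ : K ⟶ K` is the restriction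
  of `t_a^{[n]}` to the Kummer fibre (`τ ≫ j = (a, j) ≫ act`).
* FACT **`Beauville1983_kummerCover_galois`** (footnote 2 / KM Lemma 5.4, read on complex points, in the tree's
  `AlgebraicTopology.SingularHomology.FiniteDeckCover` vocabulary): `Θ(ℂ)` is a finite Galois covering of
  `H(ℂ)` by `(A × K)(ℂ)` whose deck transformations are EXACTLY the maps `(t_{b⁻¹} × τ_b)(ℂ)` for the
  `(n+1)`-torsion points `b` (`b ^ (n+1) = 1`) and their Kummer translations `τ_b` — the pull-back of the Galois
  cover `(n+1)· : A → A` (group `A[n+1] ≅ (ℤ/(n+1))⁴`, `(n+1)⁴` sheets).  With the tree's transfer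
  (`FiniteDeckCover.transferMap`, `map_proj_transferMap`: `Θ^* τ^* = Σ_g g^*`, `card_smul_eq_zero_of_map_eq_zero`)
  this yields `Θ^*` injective with image the `A[n+1]`-invariants of `H*(A × K)` — the transfer step of V0
  (OUTLOOK-n5 §11(5); BRIEF-LANE-V §4) — as a THEOREM to be written by V0's prover; Künneth
  (`HodgeTheory/ComplexBettiKunneth`) and "translations act trivially on `H*(A(ℂ))`" are the other inputs.

Junk / scope: all definitions are total; `IsTranslationAction` / `IsKummerTranslation` are predicates (no choice);
nothing here asserts V0, L1, or any case of the Hodge conjecture.  Not here: Beauville's `Σ`-map `S : A^[r+1] → A`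
itself and the equivariance `S(t_a ξ) = S(ξ) + (r+1)a` as an identity of morphisms (the tree's Kummer fibre is cut
out by the Albanese difference map `𝒜.diff`, not by `S`; the Galois-cover fact is the form V0 consumes);
`Aut₀(Kⁿ(A)) = A[n+1] ⋊ ±1` (BNWS 2011).
-/

noncomputable section

open CategoryTheory MonoidalCategory CartesianMonoidalCategory Limits
open Literature.AlgebraicGeometry.Motives (SchemeOver AbelianVariety ComplexPoints)
open Literature.AlgebraicTopology.SingularHomology (FiniteDeckCover)

namespace Literature.AlgebraicGeometry.HilbertScheme

open scoped MonObj

universe u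

/-! ### Translations of an abelian variety and the translated universal family -/

/-- **Translation `t_a : A → A`, `x ↦ a · x`**, by a point `a : Spec ℂ → A` of the abelian variety (product in the
group of morphisms `A.X ⟶ A.X`: `(toUnit ≫ a) * 𝟙`). [cite: Beauville1983, §7 p. 769]
[cite: KapferMenet2018, Lemma 5.4 (proof) p. 13] -/
def _root_.Literature.AlgebraicGeometry.Motives.AbelianVariety.translate (A : AbelianVariety ℂ)
    (a : 𝟙_ (SchemeOver ℂ) ⟶ A.X) : A.X ⟶ A.X :=
  (toUnit A.X ≫ a) * 𝟙 A.X

/-- Unfolding: `t_a = lift (toUnit ≫ a) (𝟙 A) ≫ μ`. [cite: Beauville1983, §7 p. 769] -/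
theorem _root_.Literature.AlgebraicGeometry.Motives.AbelianVariety.translate_def (A : AbelianVariety ℂ)
    (a : 𝟙_ (SchemeOver ℂ) ⟶ A.X) :
    A.translate a = lift (toUnit A.X ≫ a) (𝟙 A.X) ≫ μ :=
  rfl

variable (A : AbelianVariety ℂ)

/-- **The shear automorphism** `(x, (a, ξ)) ↦ (a⁻¹ · x, (a, ξ))` of `A × (A × H)` over `A × H`.
[cite: Beauville1983, §7 p. 769] -/
def translateShear (H : SchemeOver ℂ) : A.X ⊗ (A.X ⊗ H) ⟶ A.X ⊗ (A.X ⊗ H) :=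
  lift ((snd A.X (A.X ⊗ H) ≫ fst A.X H)⁻¹ * fst A.X (A.X ⊗ H)) (snd A.X (A.X ⊗ H))

/-- The shear commutes with the projection to the base `A × H` (it is an automorphism of `A × (A × H)` OVER
`A × H`). [cite: Beauville1983, §7 p. 769] -/
theorem translateShear_snd (H : SchemeOver ℂ) :
    translateShear A H ≫ snd A.X (A.X ⊗ H) = snd A.X (A.X ⊗ H) := by
  simp [translateShear]

/-- The inverse shear `(x, (a, ξ)) ↦ (a · x, (a, ξ))`. [cite: Beauville1983, §7 p. 769] -/
def translateShearInv (H : SchemeOver ℂ) : A.X ⊗ (A.X ⊗ H) ⟶ A.X ⊗ (A.X ⊗ H) :=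
  lift ((snd A.X (A.X ⊗ H) ≫ fst A.X H) * fst A.X (A.X ⊗ H)) (snd A.X (A.X ⊗ H))

/-- `shear ∘ shear⁻¹ = id`. [cite: Beauville1983, §7 p. 769] -/
theorem translateShear_comp_translateShearInv (H : SchemeOver ℂ) :
    translateShear A H ≫ translateShearInv A H = 𝟙 _ := by
  simp only [translateShear, translateShearInv, comp_lift, lift_snd, MonObj.comp_mul, lift_snd_assoc, lift_fst,
    mul_inv_cancel_left, lift_fst_snd]

/-- `shear⁻¹ ∘ shear = id`. [cite: Beauville1983, §7 p. 769] -/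
theorem translateShearInv_comp_translateShear (H : SchemeOver ℂ) :
    translateShearInv A H ≫ translateShear A H = 𝟙 _ := by
  simp only [translateShear, translateShearInv, comp_lift, lift_snd, MonObj.comp_mul, GrpObj.comp_inv,
    lift_snd_assoc, lift_fst, inv_mul_cancel_left, lift_fst_snd]

/-- The shear is an isomorphism (a lemma, not an instance). [cite: Beauville1983, §7 p. 769] -/
theorem isIso_translateShear (H : SchemeOver ℂ) : IsIso (translateShear A H) :=
  ⟨⟨translateShearInv A H, translateShear_comp_translateShearInv A H, translateShearInv_comp_translateShear A H⟩⟩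

variable {A}

/-- **The translated universal family** over `A × H`: the closed subscheme `{(x, (a, ξ)) | a⁻¹x ∈ Ξ_ξ}` of
`A × (A × H)` — the base change of `Ξ ⊂ A × H` along `pr₂ : A × H → H`, pulled back by the shear — whose fibre
over `(a, ξ)` is the translate `t_a(Ξ_ξ)`. [cite: Beauville1983, §7 p. 769] [cite: StacksProject, Tag 0B94] -/
def translatedFamily {H : SchemeOver ℂ} (Ξ : (A.X ⊗ H).left.IdealSheafData) :
    (A.X ⊗ (A.X ⊗ H)).left.IdealSheafData :=
  (Ξ.comap (A.X ◁ snd A.X H).left).comap (translateShear A H).left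

/-- **`act : A × H → H` is the translation action on the Hilbert scheme `(H, Ξ)`**: it classifies the translated
universal family, `(A × act)^* Ξ = translatedFamily Ξ`, i.e. `Ξ_{act(a, ξ)} = t_a(Ξ_ξ)` for all `(a, ξ)`
("`t_a` the morphism on `A^[n]` induced by the translation by `a`"). [cite: KapferMenet2018, Lemma 5.4 (proof) p. 13]
[cite: Beauville1983, §7 p. 769] [cite: StacksProject, Tag 0B94] -/
def IsTranslationAction {H : SchemeOver ℂ} (Ξ : (A.X ⊗ H).left.IdealSheafData) (act : A.X ⊗ H ⟶ H) : Prop :=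
  Ξ.comap (A.X ◁ act).left = translatedFamily Ξ

/-- The translation action is unique (universal property of the Hilbert scheme). [cite: StacksProject, Tag 0B94] -/
theorem IsTranslationAction.unique {n : ℕ} {H : SchemeOver ℂ} {Ξ : (A.X ⊗ H).left.IdealSheafData}
    (hH : IsHilbertSchemeOfPoints n A.X H Ξ) {act act' : A.X ⊗ H ⟶ H} (h : IsTranslationAction Ξ act)
    (h' : IsTranslationAction Ξ act') : act = act' :=
  hH.hom_ext (h.trans h'.symm)

/-- **Translation by the point `a` on the Hilbert scheme**: `t_a^{[n]} = act(a, ·) : H → H`.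
[cite: KapferMenet2018, Lemma 5.4 (proof) p. 13] -/
def translateHilb {H : SchemeOver ℂ} (act : A.X ⊗ H ⟶ H) (a : 𝟙_ (SchemeOver ℂ) ⟶ A.X) : H ⟶ H :=
  lift (toUnit H ≫ a) (𝟙 H) ≫ act

/-- **Beauville's `u`, Kapfer–Menet's `Θ`**: `A × K → A^[n]`, `(a, ξ) ↦ t_a(j ξ)`, for a Kummer fibre
`j : K ⟶ H`. [cite: Beauville1983, §7 p. 769 footnote 2] [cite: KapferMenet2018, Lemma 5.4 (proof) p. 13] -/
def kummerCover {H K : SchemeOver ℂ} (act : A.X ⊗ H ⟶ H) (j : K ⟶ H) : A.X ⊗ K ⟶ H :=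
  (A.X ◁ j) ≫ act

/-- **`τ : K → K` is the translation by `a` restricted to the Kummer fibre**: `j ∘ τ = t_a^{[n]} ∘ j`.
(For `a ∈ A[n+1]` the translation preserves `K = S⁻¹(0)` since `S(t_a ξ) = S(ξ) + (n+1)a`.)
[cite: Beauville1983, §7 p. 769] -/
def IsKummerTranslation {H K : SchemeOver ℂ} (act : A.X ⊗ H ⟶ H) (j : K ⟶ H) (a : 𝟙_ (SchemeOver ℂ) ⟶ A.X)
    (τ : K ⟶ K) : Prop :=
  τ ≫ j = j ≫ translateHilb act a

/-- A Kummer translation is determined by `a` when `j` is a monomorphism (the Kummer fibre is a closed subscheme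
of `A^[n+1]`). [cite: Beauville1983, §7 p. 769] -/
theorem IsKummerTranslation.unique {H K : SchemeOver ℂ} {act : A.X ⊗ H ⟶ H} {j : K ⟶ H} [Mono j]
    {a : 𝟙_ (SchemeOver ℂ) ⟶ A.X} {τ τ' : K ⟶ K} (h : IsKummerTranslation act j a τ)
    (h' : IsKummerTranslation act j a τ') : τ = τ' := by
  rw [← cancel_mono j]
  exact h.trans h'.symm

/-! ### Named facts -/

/-- **Beauville: "le groupe `A` agit sur `A^[r+1]` par translations"** — for every abelian surface `A` (indeed
every abelian variety) and every Hilbert scheme `(H, Ξ)` of `n` points of `A`, the translated universal family is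
classified by a (unique, `IsTranslationAction.unique`) morphism `act : A × H → H`, the translation action.
(Existence amounts to the flatness/degree-`n` of the translated family, an automorphic image of the base-changed
universal family: PROVED below, `Beauville1983_hilbertScheme_translationAction_holds`.) [cite: Beauville1983, §7 p. 769]
[cite: KapferMenet2018, Lemma 5.4 (proof) p. 13 ("t_a the morphism on A^[n] induced by the translation by a")] -/
def Beauville1983_hilbertScheme_translationAction : Prop :=
  ∀ (A : AbelianVariety ℂ) (n : ℕ) (H : SchemeOver ℂ) (Ξ : (A.X ⊗ H).left.IdealSheafData),
    IsHilbertSchemeOfPoints n A.X H Ξ → ∃ act : A.X ⊗ H ⟶ H, IsTranslationAction Ξ act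

/-- **The translated universal family is a point of the Hilbert functor**: `translatedFamily Ξ ∈ Hilb^n_A(A × H)` —
it is the image of the base change `Ξ_{A × H}` (in `Hilb^n`, `comap_whiskerLeft_mem`) under the shear, an automorphism
of `A × (A × H)` OVER `A × H`, and "finite locally free of degree `n` over the base" is invariant under such
automorphisms (`Scheme.IdealSheafData.comapIso`, `IsFiniteLocallyFreeOfRank.iso_comp_iff`).
[cite: Beauville1983, §7 p. 769] [cite: StacksProject, Tag 0B94] -/
theorem translatedFamily_mem {n : ℕ} {H : SchemeOver ℂ} {Ξ : (A.X ⊗ H).left.IdealSheafData}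
    (hH : IsHilbertSchemeOfPoints n A.X H Ξ) :
    translatedFamily Ξ ∈ hilbertFunctorOfPoints n A.X (A.X ⊗ H) := by
  have hJ : Ξ.comap (A.X ◁ snd A.X H).left ∈ hilbertFunctorOfPoints n A.X (A.X ⊗ H) :=
    comap_whiskerLeft_mem hH.mem _
  set J := Ξ.comap (A.X ◁ snd A.X H).left
  haveI : IsIso (translateShear A H) := isIso_translateShear A H
  haveI : IsIso (translateShear A H).left :=
    (inferInstance : IsIso ((Over.forget _).map (translateShear A H)))
  set σ := (translateShear A H).left with hσ
  have hσsnd : σ ≫ (snd A.X (A.X ⊗ H)).left = (snd A.X (A.X ⊗ H)).left := by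
    rw [hσ, ← Over.comp_left, translateShear_snd]
  rw [mem_hilbertFunctorOfPoints_iff, translatedFamily, ← AlgebraicGeometry.Scheme.IdealSheafData.comapIso_hom_fst, Category.assoc,
    IsFiniteLocallyFreeOfRank.iso_comp_iff]
  have e : pullback.fst σ J.subschemeι ≫ (snd A.X (A.X ⊗ H)).left =
      pullback.snd σ J.subschemeι ≫ (J.subschemeι ≫ (snd A.X (A.X ⊗ H)).left) := by
    rw [← Category.assoc, ← pullback.condition, Category.assoc, hσsnd]
  rw [e, IsFiniteLocallyFreeOfRank.iso_comp_iff]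
  exact hJ

/-- **The translation action exists** (discharge of `Beauville1983_hilbertScheme_translationAction`): `act` is the
classifying morphism (`IsHilbertSchemeOfPoints.lift`) of the translated universal family. [cite: Beauville1983, §7 p. 769]
[cite: StacksProject, Tag 0B94] -/
theorem Beauville1983_hilbertScheme_translationAction_holds : Beauville1983_hilbertScheme_translationAction :=
  fun _ _ _ _ hH ↦ ⟨hH.lift _ _ (translatedFamily_mem hH), hH.comap_lift _ _ _⟩

/-- **The translation action of `A` on a Hilbert scheme `(H, Ξ)` of points of `A`** (a definite morphism: the
classifying map of the translated family). [cite: Beauville1983, §7 p. 769] [cite: KapferMenet2018, Lemma 5.4 (proof) p. 13] -/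
def translationAction {n : ℕ} {H : SchemeOver ℂ} {Ξ : (A.X ⊗ H).left.IdealSheafData}
    (hH : IsHilbertSchemeOfPoints n A.X H Ξ) : A.X ⊗ H ⟶ H :=
  hH.lift _ _ (translatedFamily_mem hH)

/-- `translationAction hH` is a translation action. [cite: Beauville1983, §7 p. 769] -/
theorem isTranslationAction_translationAction {n : ℕ} {H : SchemeOver ℂ} {Ξ : (A.X ⊗ H).left.IdealSheafData}
    (hH : IsHilbertSchemeOfPoints n A.X H Ξ) : IsTranslationAction Ξ (translationAction hH) :=
  hH.comap_lift _ _ _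

/-- Any translation action is `translationAction hH`. [cite: StacksProject, Tag 0B94] -/
theorem IsTranslationAction.eq_translationAction {n : ℕ} {H : SchemeOver ℂ} {Ξ : (A.X ⊗ H).left.IdealSheafData}
    (hH : IsHilbertSchemeOfPoints n A.X H Ξ) {act : A.X ⊗ H ⟶ H} (h : IsTranslationAction Ξ act) :
    act = translationAction hH :=
  h.unique hH (isTranslationAction_translationAction hH)

/-- **Beauville's isotrivial square / Kapfer–Menet Lemma 5.4: `Θ : A × Kⁿ(A) → A^[n+1]` is a Galois cover with
group `A[n+1]`.**  For an abelian surface `A`, a Hilbert scheme `(H, Ξ)` of `n + 1` points, smooth projective of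
dimension `2(n+1)`, with translation action `act`, and a Kummer fibre `j : K ⟶ H` (fibre of the Albanese
difference map over the unit, `K` smooth projective of dimension `2n` — the clauses of
`Hyperkaehler.IsGeneralizedKummerVarietyOf n A K`): on complex points, `Θ(ℂ) : (A × K)(ℂ) → H(ℂ)` is a finite
regular covering (`FiniteDeckCover`) whose deck transformations are precisely the maps `(t_{b⁻¹} × τ_b)(ℂ)` for the
points `b` with `b^{n+1} = 1` and their Kummer translations `τ_b` ("on a un diagramme cartésien `A × K_r → A^[r+1]`
over `(r+1) : A → A`"; "realizes `K_{n−1}(A) × A` as a `n⁴`-fold covering of `A^[n]` over `A`").  The transfer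
consequences (`Θ^*` injective with image the invariants) follow from the tree's `FiniteDeckCover.transferMap`.
[cite: Beauville1983, §7 p. 769 footnote 2] [cite: KapferMenet2018, Lemma 5.4 p. 13] -/
def Beauville1983_kummerCover_galois : Prop :=
  ∀ ⦃n : ℕ⦄ ⦃A : AbelianVariety ℂ⦄ ⦃K H : SchemeOver ℂ⦄, A.dim = 2 →
    ∀ (Ξ : (A.X ⊗ H).left.IdealSheafData) (𝒜 : Motives.Jacobian H) (x₀ : 𝟙_ (SchemeOver ℂ) ⟶ H) (j : K ⟶ H)
      (act : A.X ⊗ H ⟶ H), IsHilbertSchemeOfPoints (n + 1) A.X H Ξ →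
      Motives.IsSmoothProjective (2 * (n + 1)) H →
      IsPullback j (toUnit K) (lift (𝟙 H) (toUnit H ≫ x₀) ≫ 𝒜.diff) (1 : 𝟙_ (SchemeOver ℂ) ⟶ 𝒜.J.X) →
      Motives.IsSmoothProjective (2 * n) K → IsTranslationAction Ξ act →
      ∃ (G : Type) (_ : Group G) (_ : Fintype G) (_ : MulAction G (ComplexPoints (A.X ⊗ K)))
        (c : FiniteDeckCover G (ComplexPoints (A.X ⊗ K)) (ComplexPoints H)),
        c.proj = Motives.AlgPoints.mapContinuous (L := ℂ) (kummerCover act j) ∧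
        Nat.card G = (n + 1) ^ 4 ∧
        (∀ g : G, ∃ (b : 𝟙_ (SchemeOver ℂ) ⟶ A.X) (τ : K ⟶ K), b ^ (n + 1) = 1 ∧
          IsKummerTranslation act j b τ ∧ c.deck g = Motives.AlgPoints.mapContinuous (L := ℂ) (A.translate b⁻¹ ⊗ₘ τ)) ∧
        (∀ (b : 𝟙_ (SchemeOver ℂ) ⟶ A.X), b ^ (n + 1) = 1 → ∃ (g : G) (τ : K ⟶ K),
          IsKummerTranslation act j b τ ∧ c.deck g = Motives.AlgPoints.mapContinuous (L := ℂ) (A.translate b⁻¹ ⊗ₘ τ))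

end Literature.AlgebraicGeometry.HilbertScheme

end
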